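import Summits.Ventures.CertifiedManyBodySolver.Theorems.TcThermcert1FreeGasEsymmInputs
import Summits.Ventures.CertifiedManyBodySolver.Theorems.TcThermcert1FreeGasDefs
import Summits.Ventures.CertifiedManyBodySolver.Theorems.TcThermcert1FreeCanonicalModeAnticoncentration
import HarnessLib

/-!
# Free canonical gas at `β·t = 8` — S3 completed: Poisson-binomial moments of `j ↦ e_j(x) t^j` and the sector-weight floor at a mode

Helper file for route `TcThermcert1` (crux K1′ `ThermalStiffnessCeilingU8b8_le_7o44`, item `stmt-Ventures-24560`), crux idea
`free-canonical-b8-rung` (stub S3 `stub_sectorWeight_at_mode` of `Cruxes/ThermalStiffnessCeilingU8b10_le_1o8/FreeCanonicalB8Sketch.lean`).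

The weights `w_j = e_j(x) t^j` (elementary symmetric functions of non-negative reals `xᵢ` at a fugacity `t ≥ 0`) are, after division
by `∏ᵢ (1 + t xᵢ)`, the Poisson-binomial law of `N = Σᵢ Bernoulli(pᵢ)`, `pᵢ = t xᵢ/(1 + t xᵢ)`. §1–§2 prove the three moment
identities by the Viète recursion `e_{j+1}(a ∷ X) = e_{j+1}(X) + a e_j(X)` (a weighted form of the tree's mass identity
`FreeGasArc.Inputs.sum_esymm_mul_pow`):

  `Σ_j e_j t^j = ∏ (1 + t a)`,  `Σ_j j e_j t^j = (Σ_a p_a) ∏ (1 + t a)`,  `Σ_j j² e_j t^j = (Σ_a p_a(1 − p_a) + (Σ_a p_a)²) ∏ (1 + t a)`,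

hence the centred identity `Σ_j (j − Σ p_a)² e_j t^j = (Σ_a t a/(1 + t a)²) · ∏ (1 + t a)` (variance `σ_t² = Σ pᵢ(1 − pᵢ)`). §3 feeds
this Chebyshev datum into `mode_weight_anticoncentration` (`Theorems/TcThermcert1FreeCanonicalModeAnticoncentration.lean`):
at any fugacity `t ≥ 0` making `M` a mode of `j ↦ e_j(x) t^j`,

  `3 ∏ᵢ (1 + t xᵢ) ≤ 4 (4 σ_t + 3) · e_M(x) t^M`,   `σ_t = √(Σᵢ t xᵢ/(1 + t xᵢ)²)`

— stub S3 of the sketch with the elementary constant `3/(4(4σ + 3))` in place of Bobkov–Marsiglietti–Melbourne's `1/√(1 + 12σ²)`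
(mode existence: the tree's `FreeGasArc.Inputs.exists_modeFugacity_pinned`). No Literature fact is used.

HONEST LABEL: elementary algebra/probability; a step of a RUNG (`U = 0`, BC5-type witness for the C8 bet), reach at `U = 8` ZERO;
decides nothing about K1/K1′/`T_c`; superconductivity in the Hubbard model is NOT proved or advanced by this file beyond the rung.
-/

noncomputable section

namespace Summit.Ventures.CertifiedManyBodySolver.Theorems.TcThermcert1.FreeCanonicalB8

open Finset Real
open Literature.Geometry.Riemannian (esymm_zero_eq_one esymm_nonneg_of_forall_nonneg esymm_eq_zero_of_card_lt esymm_cons_succ)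
open Summit.Ventures.CertifiedManyBodySolver.Theorems.FreeGasArc.Inputs (esymmW esymmW_eq_esymm sum_esymm_mul_pow)

/-! ## §1 The weighted Viète step -/

/-- **Weighted Viète step.** For every weight `f : ℕ → ℝ`:
`Σ_{j ≤ |X|+1} f(j) e_j(x ∷ X) t^j = Σ_{j ≤ |X|} f(j) e_j(X) t^j + t x Σ_{j ≤ |X|} f(j+1) e_j(X) t^j`. -/
theorem sum_mul_esymm_cons (f : ℕ → ℝ) (x t : ℝ) (X : Multiset ℝ) :
    ∑ j ∈ Finset.range (Multiset.card X + 2), f j * ((x ::ₘ X).esymm j * t ^ j) =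
      ∑ j ∈ Finset.range (Multiset.card X + 1), f j * (X.esymm j * t ^ j) +
        t * x * ∑ j ∈ Finset.range (Multiset.card X + 1), f (j + 1) * (X.esymm j * t ^ j) := by
  set n := Multiset.card X with hn
  have h0 : X.esymm (n + 1) = 0 := esymm_eq_zero_of_card_lt X (by omega)
  have hA : ∑ i ∈ Finset.range (n + 1), f (i + 1) * (X.esymm (i + 1) * t ^ (i + 1)) =
      ∑ i ∈ Finset.range n, f (i + 1) * (X.esymm (i + 1) * t ^ (i + 1)) := by
    rw [Finset.sum_range_succ, h0, zero_mul, mul_zero, add_zero]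
  have hterm : ∀ i ∈ Finset.range (n + 1), f (i + 1) * ((x ::ₘ X).esymm (i + 1) * t ^ (i + 1)) =
      f (i + 1) * (X.esymm (i + 1) * t ^ (i + 1)) + t * x * (f (i + 1) * (X.esymm i * t ^ i)) := by
    intro i _
    rw [esymm_cons_succ]
    ring
  rw [Finset.sum_range_succ' _ (n + 1), Finset.sum_congr rfl hterm, Finset.sum_add_distrib, hA, ← Finset.mul_sum,
    Finset.sum_range_succ' (fun j => f j * (X.esymm j * t ^ j)) n, esymm_zero_eq_one, esymm_zero_eq_one]
  ring

/-! ## §2 The moment identities -/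

/-- **First moment**: `Σ_j j e_j(X) t^j = (Σ_{a∈X} t a/(1 + t a)) · ∏_{a∈X} (1 + t a)` for `t ≥ 0` and non-negative `X`. -/
theorem sum_natCast_mul_esymm_mul_pow (X : Multiset ℝ) (hX : ∀ a ∈ X, 0 ≤ a) {t : ℝ} (ht : 0 ≤ t) :
    ∑ j ∈ Finset.range (Multiset.card X + 1), (j : ℝ) * (X.esymm j * t ^ j) =
      (X.map fun a => t * a / (1 + t * a)).sum * (X.map fun a => 1 + t * a).prod := by
  induction X using Multiset.induction with
  | empty => simp [esymm_zero_eq_one]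
  | cons x X ih =>
    have hx : 0 ≤ x := hX x (Multiset.mem_cons_self x X)
    have hX' : ∀ a ∈ X, 0 ≤ a := fun a ha => hX a (Multiset.mem_cons_of_mem ha)
    have h1x : (1 + t * x) ≠ 0 := by positivity
    have hmass := sum_esymm_mul_pow X t
    rw [Multiset.card_cons, sum_mul_esymm_cons (fun j => (j : ℝ)) x t X, Multiset.map_cons, Multiset.sum_cons, Multiset.map_cons,
      Multiset.prod_cons]
    have hshift : ∑ j ∈ Finset.range (Multiset.card X + 1), ((j + 1 : ℕ) : ℝ) * (X.esymm j * t ^ j) =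
        ∑ j ∈ Finset.range (Multiset.card X + 1), (j : ℝ) * (X.esymm j * t ^ j) +
          ∑ j ∈ Finset.range (Multiset.card X + 1), X.esymm j * t ^ j := by
      rw [← Finset.sum_add_distrib]
      refine Finset.sum_congr rfl fun j _ => ?_
      push_cast
      ring
    rw [hshift, ih hX', hmass]
    field_simp
    ring

/-- **Second moment**: `Σ_j j² e_j(X) t^j = (Σ_a t a/(1+ta)² + (Σ_a t a/(1+ta))²) · ∏_a (1 + t a)` for `t ≥ 0`, non-negative `X`. -/
theorem sum_natCast_sq_mul_esymm_mul_pow (X : Multiset ℝ) (hX : ∀ a ∈ X, 0 ≤ a) {t : ℝ} (ht : 0 ≤ t) :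
    ∑ j ∈ Finset.range (Multiset.card X + 1), (j : ℝ) ^ 2 * (X.esymm j * t ^ j) =
      ((X.map fun a => t * a / (1 + t * a) ^ 2).sum + ((X.map fun a => t * a / (1 + t * a)).sum) ^ 2) *
        (X.map fun a => 1 + t * a).prod := by
  induction X using Multiset.induction with
  | empty => simp [esymm_zero_eq_one]
  | cons x X ih =>
    have hx : 0 ≤ x := hX x (Multiset.mem_cons_self x X)
    have hX' : ∀ a ∈ X, 0 ≤ a := fun a ha => hX a (Multiset.mem_cons_of_mem ha)
    have h1x : (1 + t * x) ≠ 0 := by positivity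
    have hmass := sum_esymm_mul_pow X t
    have hfirst := sum_natCast_mul_esymm_mul_pow X hX' ht
    rw [Multiset.card_cons, sum_mul_esymm_cons (fun j => (j : ℝ) ^ 2) x t X, Multiset.map_cons, Multiset.sum_cons, Multiset.map_cons,
      Multiset.sum_cons, Multiset.map_cons, Multiset.prod_cons]
    have hshift : ∑ j ∈ Finset.range (Multiset.card X + 1), ((j + 1 : ℕ) : ℝ) ^ 2 * (X.esymm j * t ^ j) =
        ∑ j ∈ Finset.range (Multiset.card X + 1), (j : ℝ) ^ 2 * (X.esymm j * t ^ j) +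
          2 * ∑ j ∈ Finset.range (Multiset.card X + 1), (j : ℝ) * (X.esymm j * t ^ j) +
          ∑ j ∈ Finset.range (Multiset.card X + 1), X.esymm j * t ^ j := by
      rw [Finset.mul_sum, ← Finset.sum_add_distrib, ← Finset.sum_add_distrib]
      refine Finset.sum_congr rfl fun j _ => ?_
      push_cast
      ring
    rw [hshift, ih hX', hfirst, hmass]
    field_simp
    ring

/-- **Centred second moment (variance identity)**: with `m = Σ_a t a/(1 + t a)`,
`Σ_j (j − m)² e_j(X) t^j = (Σ_a t a/(1 + t a)²) · ∏_a (1 + t a)`. -/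
theorem sum_sq_sub_mean_mul_esymm_mul_pow (X : Multiset ℝ) (hX : ∀ a ∈ X, 0 ≤ a) {t : ℝ} (ht : 0 ≤ t) :
    ∑ j ∈ Finset.range (Multiset.card X + 1), ((j : ℝ) - (X.map fun a => t * a / (1 + t * a)).sum) ^ 2 * (X.esymm j * t ^ j) =
      (X.map fun a => t * a / (1 + t * a) ^ 2).sum * (X.map fun a => 1 + t * a).prod := by
  set m := (X.map fun a => t * a / (1 + t * a)).sum with hm
  have hexp : ∀ j ∈ Finset.range (Multiset.card X + 1), ((j : ℝ) - m) ^ 2 * (X.esymm j * t ^ j) =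
      (j : ℝ) ^ 2 * (X.esymm j * t ^ j) - 2 * m * ((j : ℝ) * (X.esymm j * t ^ j)) + m ^ 2 * (X.esymm j * t ^ j) := by
    intro j _
    ring
  rw [Finset.sum_congr rfl hexp, Finset.sum_add_distrib, Finset.sum_sub_distrib, ← Finset.mul_sum, ← Finset.mul_sum,
    sum_natCast_sq_mul_esymm_mul_pow X hX ht, sum_natCast_mul_esymm_mul_pow X hX ht, sum_esymm_mul_pow X t, ← hm]
  ring

/-! ## §3 S3: the sector weight at a mode, `Fintype` form -/

/-- **S3 (variance-only floor at a mode, `Fintype` form).** For non-negative weights `xᵢ`, a fugacity `t ≥ 0` and an index `M` that is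
a mode of `j ↦ e_j(x) t^j`: `3 ∏ᵢ (1 + t xᵢ) ≤ 4 (4σ_t + 3) · e_M(x) t^M` with `σ_t = √(Σᵢ t xᵢ/(1 + t xᵢ)²)`, i.e. the Poisson-binomial
probability of the mode is at least `3/(4(4σ_t + 3))`. (Stub S3 of `FreeCanonicalB8Sketch` up to the constant; the existence of a
mode fugacity off the poles is the tree's `exists_modeFugacity_pinned`.) -/
theorem esymmW_mode_anticoncentration {ι : Type} [Fintype ι] [DecidableEq ι] (x : ι → ℝ) (hx : ∀ i, 0 ≤ x i) {t : ℝ}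
    (ht : 0 ≤ t) {M : ℕ} (hmode : ∀ j : ℕ, esymmW x j * t ^ j ≤ esymmW x M * t ^ M) :
    3 * ∏ i, (1 + t * x i) ≤ 4 * (4 * Real.sqrt (∑ i, t * x i / (1 + t * x i) ^ 2) + 3) * (esymmW x M * t ^ M) := by
  set X : Multiset ℝ := (Finset.univ : Finset ι).val.map x with hXdef
  have hcard : Multiset.card X = Fintype.card ι := by rw [hXdef, Multiset.card_map]; rfl
  have hXnn : ∀ a ∈ X, 0 ≤ a := by
    intro a ha
    obtain ⟨i, _, rfl⟩ := Multiset.mem_map.1 ha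
    exact hx i
  have hW : ∀ j, esymmW x j = X.esymm j := fun j => esymmW_eq_esymm x j
  have hprod : (X.map fun a => 1 + t * a).prod = ∏ i, (1 + t * x i) := by
    rw [hXdef, Multiset.map_map]; rfl
  have hsum1 : (X.map fun a => t * a / (1 + t * a)).sum = ∑ i, t * x i / (1 + t * x i) := by
    rw [hXdef, Multiset.map_map]; rfl
  have hsum2 : (X.map fun a => t * a / (1 + t * a) ^ 2).sum = ∑ i, t * x i / (1 + t * x i) ^ 2 := by
    rw [hXdef, Multiset.map_map]; rfl
  set s := Finset.range (Fintype.card ι + 1) with hs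
  set w : ℕ → ℝ := fun j => esymmW x j * t ^ j with hw
  have hw0 : ∀ j, 0 ≤ w j := fun j => by
    rw [hw]
    exact mul_nonneg (by rw [hW]; exact esymm_nonneg_of_forall_nonneg X hXnn j) (pow_nonneg ht j)
  have hmass : ∑ j ∈ s, w j = ∏ i, (1 + t * x i) := by
    simp only [hw, hs, hW, ← hcard, ← hprod]
    exact sum_esymm_mul_pow X t
  have hv0 : 0 ≤ ∑ i, t * x i / (1 + t * x i) ^ 2 :=
    Finset.sum_nonneg fun i _ => by have := hx i; positivity
  have hvar : ∑ j ∈ s, ((j : ℝ) - ∑ i, t * x i / (1 + t * x i)) ^ 2 * w j ≤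
      (Real.sqrt (∑ i, t * x i / (1 + t * x i) ^ 2)) ^ 2 * ∑ j ∈ s, w j := by
    rw [Real.sq_sqrt hv0, hmass, ← hsum1, ← hsum2, ← hprod]
    simp only [hw, hs, hW, ← hcard]
    exact (sum_sq_sub_mean_mul_esymm_mul_pow X hXnn ht).le
  have key := mode_weight_anticoncentration s w (fun j _ => hw0 j) (hw0 M) (fun j _ => hmode j)
    (∑ i, t * x i / (1 + t * x i)) (Real.sqrt (∑ i, t * x i / (1 + t * x i) ^ 2)) (Real.sqrt_nonneg _) hvar
  rw [hmass] at key
  exact key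

end Summit.Ventures.CertifiedManyBodySolver.Theorems.TcThermcert1.FreeCanonicalB8

end
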